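import Literature.NumberTheory.EllipticCurves.TianYuanZhang2017.RhoIndexMonskyKernelOdd
import Literature.NumberTheory.EllipticCurves.TianYuanZhang2017.RhoIndexMonskyKernelEven
import Literature.NumberTheory.EllipticCurves.PeriodIndexCassels
import Literature.NumberTheory.EllipticCurves.SelmerProofs
import HarnessLib

/-!
# `ρ(n)` read off Monsky's kernel — SHARPNESS when `Ш(E_n)[2^∞] = 0` (file 4)

Files 2/3 (`RhoIndexMonskyKernelOdd/Even.lean`) prove `ρ(n) = 0` from the SHAPE of the kernel of Monsky's matrix
(odd `n`: `x + y ∈ {0, 𝟙}` for every kernel vector; even `n`: `β = 0`). THIS FILE proves the converse under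
`Ш(E_n)[2^∞] = 0` — on the rank-one leaf this is `#Sel₂(E_n) = 8` + GZK (tree
`P2.primaryComponent_sha_two_eq_bot_of_card_selmerGroup_eq_eight`):

* `exists_point_of_mem_selmer_of_sha_two_eq_bot` — if `Ш(E_n)[2^∞] = 0` then every class of `Sel⁽²⁾(E_n/ℚ)` is
  the Kummer class of a rational point (Silverman X.4.2: `0 → E(ℚ)/2E(ℚ) → Sel⁽²⁾ → Ш[2] → 0`);
* `rhoIndex_ne_one_of_kernelVector_odd` — `n = p₁⋯p_k` odd: a kernel vector `(x; y)` of Monsky's matrix with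
  `x + y ∉ {0, 𝟙}` and `Ш(E_n)[2^∞] = 0` force `ρ(n) ≥ 1` (the explicit Selmer class `c(∏pᵢ^{xᵢ}, ∏pᵢ^{xᵢ+yᵢ})`
  of the tree's `twoDescentClass_kernel_mem_selmerGroup_odd` is `κ(P)`, and `x(P) ≡ ∏pᵢ^{xᵢ+yᵢ} ∉ {±1, ±n}·ℚ^{×2}`);
* `rhoIndex_ne_one_of_kernelVector_even` — `n = 2p₁⋯p_k`: a kernel vector `(β; α)` with `β ≠ 0` and
  `Ш(E_n)[2^∞] = 0` force `ρ(n) ≥ 1` (`x(P) ≡ candB β = ±∏pᵢ^{βᵢ}`, odd and not `±` a square).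

So for `rank E_n(ℚ) = 1`, `s(n) = 1`: `ρ(n) = 0 ⟺` the kernel has the torsion shape — the census categories
A (TYZρ, flag-free) and B (U⁺ only) of the cell `bsd-print-cf2` crux `RamifiedOffTYZOfFacts` are separated by
a kernel computation, and on B the typed TYZ Thm 1.2/1.4 (`2^{ρ+1} ∣ 𝓛 → …`) is silent. Theorems only; no named
fact; nothing about BSD asserted. Cell `bsd-print-cf2`, seat p2.

## References

* [TianYuanZhang2017] Y. Tian, X. Yuan, S.-W. Zhang, Asian J. Math. 21 (2017) = arXiv:1411.4728, §1 (ρ(n)), Thm. 1.2.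
* [HeathBrown1994SelmerCongruentII] D. R. Heath-Brown, Invent. Math. 118 (1994), Appendix (P. Monsky), typescript pp. 38–41.
* [SilvermanAEC2009] J. H. Silverman, *The Arithmetic of Elliptic Curves*, 2nd ed., Thm. X.4.2, Prop. X.1.4, Prop. X.4.9.
-/

noncomputable section

open scoped Classical

open WeierstrassCurve WeierstrassCurve.Affine WeierstrassCurve.Affine.Point
open Literature.NumberTheory.GaloisRepresentations
open Literature.NumberTheory.EllipticCurves.KramerTwoDescent
open Literature.NumberTheory.EllipticCurves.TwoDescentLocal
open Literature.NumberTheory.EllipticCurves.HeathBrown1994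
open Literature.NumberTheory.EllipticCurves.TianYuanZhang2017
open Literature.NumberTheory.EllipticCurves.FaulknerJames2007
open IsDedekindDomain NumberField Matrix

namespace Literature.NumberTheory.EllipticCurves.TianYuanZhang2017

namespace RhoMonskyKernel

/-- In `ℤ/2`, `a + 1 = 0` forces `a = 1`. [folklore] -/
private theorem eq_one_of_add_one_eq_zero {a : ZMod 2} (h : a + 1 = 0) : a = 1 := by
  revert a h; decide

/-- A rational square has even `p`-adic valuation, as a parity bit. [folklore] -/
private theorem parityBit_eq_zero_of_sqClass_eq_one {p : ℕ} [Fact p.Prime] {a : ℚ} (ha : a ≠ 0)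
    (h : sqClass a = 1) : parityBit p a = 0 := by
  obtain ⟨u, hu⟩ := (sqClass_eq_one_iff ha).mp h
  have hu0 : u ≠ 0 := by rintro rfl; exact ha (by rw [hu]; ring)
  rw [hu, parityBit_eq_zero_iff, sq, padicValRat.mul hu0 hu0]
  exact Even.add_self _

/-- Two square classes are equal iff the product is a square. [folklore] -/
private theorem sqClass_mul_eq_one_of_eq {a b : ℚ} (ha : a ≠ 0) (hb : b ≠ 0) (h : sqClass a = sqClass b) :
    sqClass (a * b) = 1 := by
  rw [sqClass_mul ha hb, h, SqUnits.mul_self]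

/-- A negative rational is not in the trivial square class. [folklore] -/
private theorem sqClass_ne_one_of_neg {a : ℚ} (ha : a < 0) : sqClass a ≠ 1 := by
  intro h
  obtain ⟨u, hu⟩ := (sqClass_eq_one_iff ha.ne).mp h
  nlinarith [sq_nonneg u]

/-! ### Selmer classes are Kummer classes when `Ш(E_n)[2^∞] = 0` -/

/-- **`Sel⁽²⁾(E_n/ℚ) ⊆ κ(E_n(ℚ))` when `Ш(E_n)[2^∞] = 0`**: the image of a Selmer class in `H¹(ℚ, E)` lies in
`Ш(E_n)` and is killed by `2`, hence lies in `Ш[2^∞] = 0`, so the class is a Kummer class (exactness of the Kummer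
sequence at `H¹(ℚ, E[2])`). [cite: SilvermanAEC2009, Thm. X.4.2 (a)] -/
theorem exists_point_of_mem_selmer_of_sha_two_eq_bot {n : ℕ} (hn : n ≠ 0)
    (hsha : haveI := isElliptic_congruentNumberCurve hn;
      AddCommGroup.primaryComponent (congruentNumberCurve n).sha 2 = ⊥)
    (hdiv : ∀ Q : geomPoints (congruentNumberCurve n), ∃ R : geomPoints (congruentNumberCurve n), (2 : ℤ) • R = Q)
    {c : galH1Torsion (congruentNumberCurve n) 2}
    (hc : haveI := isElliptic_congruentNumberCurve hn; c ∈ (congruentNumberCurve n).selmerGroup 2) :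
    ∃ P : (congruentNumberCurve n).toAffine.Point, kummerMapTorsion (congruentNumberCurve n) 2 hdiv P = c := by
  haveI := isElliptic_congruentNumberCurve hn
  haveI : Fact (Nat.Prime 2) := ⟨Nat.prime_two⟩
  have hmem : torsionH1ToH1 (congruentNumberCurve n) 2 c ∈ (congruentNumberCurve n).sha :=
    torsionH1ToH1_mem_sha_of_mem_selmerGroup (congruentNumberCurve n) two_ne_zero hc
  set s : (congruentNumberCurve n).sha := ⟨_, hmem⟩ with hs
  have h2 : (2 : ℤ) • torsionH1ToH1 (congruentNumberCurve n) 2 c = 0 :=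
    WeierstrassCurve.torsionH1ToH1_mem_torsionBy (congruentNumberCurve n) 2 c
  have hprim : s ∈ AddCommGroup.primaryComponent (congruentNumberCurve n).sha 2 := by
    rw [AddCommGroup.mem_primaryComponent]
    refine ⟨1, Subtype.ext ?_⟩
    rw [pow_one, AddSubgroup.coe_nsmul, AddSubgroup.coe_zero]
    change (2 : ℕ) • torsionH1ToH1 (congruentNumberCurve n) 2 c = 0
    rw [← natCast_zsmul]
    exact h2
  rw [hsha, AddSubgroup.mem_bot] at hprim
  have h0 : torsionH1ToH1 (congruentNumberCurve n) 2 c = 0 := congrArg Subtype.val hprim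
  obtain ⟨P, hP⟩ := mem_range_kummerMapTorsion_of_torsionH1ToH1_eq_zero (congruentNumberCurve n) 2 hdiv c h0
  exact ⟨P, hP⟩

/-- **The `x`-class of the point behind a Selmer class**: if `κ(P) = c` and the `b`-component of `c` is `[b]`,
then `x(P) (mod ℚ^{×2}) = [b]` (the Kummer bridge, Silverman X.1.4). [cite: SilvermanAEC2009, Thm. X.1.1, Prop. X.1.4] -/
theorem sqClass_descentRep_eq_of_kummer {n : ℕ} (hn : n ≠ 0)
    (hdiv : ∀ Q : geomPoints (congruentNumberCurve n), ∃ R : geomPoints (congruentNumberCurve n), (2 : ℤ) • R = Q)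
    {P : (congruentNumberCurve n).toAffine.Point} {c : galH1Torsion (congruentNumberCurve n) 2}
    (hP : kummerMapTorsion (congruentNumberCurve n) 2 hdiv P = c) (b : ℚˣ)
    (hb : haveI := isElliptic_congruentNumberCurve hn;
      kummerEquiv ℚ 2 ((congruentNumberCurve n).twoTorsionCharH1 (splitTwoTorsion_cn n).swap₁₂ c) =
        Additive.ofMul (QuotientGroup.mk b)) :
    sqClass (descentRep 0 (-(n : ℚ)) n P) = sqClass (b : ℚ) := by
  haveI := isElliptic_congruentNumberCurve hn
  have hT := splitTwoTorsion_cn n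
  have hbr := (congruentNumberCurve n).kummerEquiv_twoTorsionCharH1_kummerMapTorsion hT.swap₁₂ hdiv P
  rw [hP, hb] at hbr
  have hcl : (QuotientGroup.mk b : SqUnits ℚ) =
      twoDescentComponent (congruentNumberCurve n).toAffine 0 (-(n : ℚ)) n P := by
    have := Additive.ofMul.injective hbr
    rw [this]
    congr 1
    exact Subsingleton.elim _ _
  rw [← twoDescentComponent_eq_sqClass, ← hcl, CongruentNumberTwicePrimePairSelmer.mk_eq_sqClass]

/-! ### Odd `n`: a kernel vector of the wrong shape forces `ρ(n) ≥ 1` -/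

section Odd

open Literature.NumberTheory.EllipticCurves.CongruentNumberEvenMonskySelmer
open Literature.NumberTheory.EllipticCurves.CongruentNumberOddMonskySelmer
open Literature.NumberTheory.EllipticCurves.MonskySelmerCandidates
open Literature.NumberTheory.EllipticCurves.CongruentNumberOddMonskySelmerKernel

variable {k : ℕ} {p : Fin k → ℕ}

/-- `∏ pᵢ ≠ 0`. [folklore] -/
private theorem n_ne_zero' (hp : ∀ i, (p i).Prime) : ∏ i, p i ≠ 0 :=
  Finset.prod_ne_zero_iff.mpr fun i _ => (hp i).ne_zero

/-- **Converse for odd `n` (sharpness).** `n = p₁⋯p_k` (distinct odd primes): if Monsky's matrix has a kernel vector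
`(x; y)` with `x + y ≠ 0` and `x + y ≠ 𝟙`, and `Ш(E_n)[2^∞] = 0`, then `[E_n(ℚ) : φ_n(A_n(ℚ)) + E_n[2]] ≠ 1`, i.e.
`ρ(n) ≥ 1`: the Selmer class `c(∏pᵢ^{xᵢ}, ∏pᵢ^{xᵢ+yᵢ})` is the Kummer class of a rational point `P` with
`x(P) ≡ b := ∏pᵢ^{xᵢ+yᵢ} (mod ℚ^{×2})`, and `[b] ∉ {1, [−1], [n], [−n]}` (`b > 0`, `v_{pᵢ}(b) = xᵢ + yᵢ`).
[cite: TianYuanZhang2017, §1, definition of ρ(n)] [cite: HeathBrown1994SelmerCongruentII, Appendix (Monsky), typescript p. 39]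
[cite: SilvermanAEC2009, Thm. X.4.2, Prop. X.4.9] -/
theorem rhoIndex_ne_one_of_kernelVector_odd (hp : ∀ i, (p i).Prime) (hp2 : ∀ i, p i ≠ 2)
    (hinj : Function.Injective p) {x y : Fin k → ZMod 2}
    (hxy : monskyMatrixOdd p *ᵥ Sum.elim x y = 0) (h0 : x + y ≠ 0) (h1 : x + y ≠ fun _ => 1)
    (hsha : haveI := isElliptic_congruentNumberCurve (Finset.prod_ne_zero_iff.mpr fun i _ => (hp i).ne_zero);
      AddCommGroup.primaryComponent (congruentNumberCurve (∏ i, p i)).sha 2 = ⊥)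
    {n : ℕ} (hn : ∏ i, p i = n) : (rhoSubgroup n).index ≠ 1 := by
  subst hn
  have hn := n_ne_zero' hp
  haveI := isElliptic_congruentNumberCurve hn
  haveI : Fact (Nat.Prime 2) := ⟨Nat.prime_two⟩
  haveI : ∀ i, Fact (p i).Prime := fun i => ⟨hp i⟩
  set N : ℚ := ((∏ i, p i : ℕ) : ℚ) with hN
  have hN0 : N ≠ 0 := by rw [hN]; exact_mod_cast hn
  have hNpos : 0 < N := by rw [hN]; exact_mod_cast Nat.pos_of_ne_zero hn
  have hdiv : ∀ Q : geomPoints (congruentNumberCurve (∏ i, p i)),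
      ∃ R : geomPoints (congruentNumberCurve (∏ i, p i)), (2 : ℤ) • R = Q :=
    fun Q => (congruentNumberCurve (∏ i, p i)).zsmul_geomPoints_surjective_holds (n := 2) two_ne_zero Q
  -- the explicit Selmer class of the kernel vector and the point behind it
  have hc := twoDescentClass_kernel_mem_selmerGroup_odd hp hp2 hinj hxy
  obtain ⟨P, hP⟩ := exists_point_of_mem_selmer_of_sha_two_eq_bot hn hsha hdiv hc
  set b : ℚ := (bitProd p (x + y) : ℚ) with hb
  have hb0 : b ≠ 0 := cast_bitProd_ne_zero hp (x + y)
  have hbpos : 0 < b := by rw [hb]; exact_mod_cast bitProd_pos hp (x + y)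
  have hclass : sqClass (descentRep 0 (-N) N P) = sqClass b :=
    sqClass_descentRep_eq_of_kummer hn hdiv hP (Units.mk0 b hb0)
      ((congruentNumberCurve (∏ i, p i)).kummerEquiv_twoTorsionCharH1_swap_twoDescentClass
        (splitTwoTorsion_cn (∏ i, p i)) _ _)
  have hbit : ∀ i, parityBit (p i) b = (x + y) i := fun i => parityBit_bitProd hp hinj (x + y) i
  have hNbit : ∀ i, parityBit (p i) N = 1 := by
    intro i
    have : N = (bitProd p (fun _ => 1) : ℚ) := by rw [hN, cast_bitProd]; push_cast; simp
    rw [this, parityBit_bitProd hp hinj]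
  refine rhoIndex_ne_one_of_witness hn P ?_
  rw [hclass]
  rintro (h | h | h | h)
  · exact h0 (funext fun i => by rw [← hbit i, Pi.zero_apply]; exact parityBit_eq_zero_of_sqClass_eq_one hb0 h)
  · exact sqClass_ne_one_of_neg (by nlinarith : b * (-1) < 0) (sqClass_mul_eq_one_of_eq hb0 (by norm_num) h)
  · apply h1; funext i
    have hsq := sqClass_mul_eq_one_of_eq hb0 hN0 h
    have := parityBit_eq_zero_of_sqClass_eq_one (p := p i) (mul_ne_zero hb0 hN0) hsq
    rw [parityBit_mul hb0 hN0, hbit, hNbit] at this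
    exact eq_one_of_add_one_eq_zero this
  · exact sqClass_ne_one_of_neg (by nlinarith : b * (-N) < 0)
      (sqClass_mul_eq_one_of_eq hb0 (neg_ne_zero.mpr hN0) h)

end Odd

/-! ### Even `n`: a kernel vector with `β ≠ 0` forces `ρ(n) ≥ 1` -/

section Even

open Literature.NumberTheory.EllipticCurves.CongruentNumberEvenMonskySelmer
open Literature.NumberTheory.EllipticCurves.MonskySelmerCandidates
open Literature.NumberTheory.EllipticCurves.CongruentNumberEvenMonskySelmerKernel

variable {k : ℕ} {p : Fin k → ℕ}

/-- **Converse for even `n` (sharpness).** `n = 2p₁⋯p_k`: if Monsky's even matrix has a kernel vector `(β; α)`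
with `β ≠ 0` and `Ш(E_n)[2^∞] = 0`, then `ρ(n) ≥ 1`: the Selmer class `c(∏pᵢ^{αᵢ}, candB β)` of the tree's
`twoDescentClass_kernel_mem_selmerGroup` is `κ(P)` with `x(P) ≡ candB β = ±∏pᵢ^{βᵢ}`, an odd non-`±`square, so
`[x(P)] ∉ {1, [−1], [n], [−n]}` (`v₂(n) = 1`). [cite: TianYuanZhang2017, §1, definition of ρ(n)]
[cite: HeathBrown1994SelmerCongruentII, Appendix (Monsky), typescript p. 41] [cite: SilvermanAEC2009, Thm. X.4.2, Prop. X.4.9] -/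
theorem rhoIndex_ne_one_of_kernelVector_even (hp : ∀ i, (p i).Prime) (hp2 : ∀ i, p i ≠ 2)
    (hinj : Function.Injective p) {β α : Fin k → ZMod 2}
    (hx : monskyMatrixEven p *ᵥ Sum.elim β α = 0) (hβ : β ≠ 0)
    (hsha : haveI := isElliptic_congruentNumberCurve
                (mul_ne_zero two_ne_zero (Finset.prod_ne_zero_iff.mpr fun i _ => (hp i).ne_zero));
      AddCommGroup.primaryComponent (congruentNumberCurve (2 * ∏ i, p i)).sha 2 = ⊥)
    {n : ℕ} (hn : 2 * ∏ i, p i = n) : (rhoSubgroup n).index ≠ 1 := by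
  subst hn
  have hn : 2 * ∏ i, p i ≠ 0 := mul_ne_zero two_ne_zero (Finset.prod_ne_zero_iff.mpr fun i _ => (hp i).ne_zero)
  haveI := isElliptic_congruentNumberCurve hn
  haveI : Fact (Nat.Prime 2) := ⟨Nat.prime_two⟩
  haveI : ∀ i, Fact (p i).Prime := fun i => ⟨hp i⟩
  set N : ℚ := ((2 * ∏ i, p i : ℕ) : ℚ) with hN
  have hN0 : N ≠ 0 := by rw [hN]; exact_mod_cast hn
  have hdiv : ∀ Q : geomPoints (congruentNumberCurve (2 * ∏ i, p i)),
      ∃ R : geomPoints (congruentNumberCurve (2 * ∏ i, p i)), (2 : ℤ) • R = Q :=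
    fun Q => (congruentNumberCurve (2 * ∏ i, p i)).zsmul_geomPoints_surjective_holds (n := 2) two_ne_zero Q
  have hc := twoDescentClass_kernel_mem_selmerGroup hp hp2 hinj hx
  obtain ⟨P, hP⟩ := exists_point_of_mem_selmer_of_sha_two_eq_bot hn hsha hdiv hc
  set b : ℚ := ((candB p β : ℤ) : ℚ) with hb
  have hb0 : b ≠ 0 := cast_candB_ne_zero hp β
  have hclass : sqClass (descentRep 0 (-N) N P) = sqClass b :=
    sqClass_descentRep_eq_of_kummer hn hdiv hP (Units.mk0 b hb0)
      ((congruentNumberCurve (2 * ∏ i, p i)).kummerEquiv_twoTorsionCharH1_swap_twoDescentClass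
        (splitTwoTorsion_cn (2 * ∏ i, p i)) _ _)
  have hbit : ∀ i, parityBit (p i) b = β i := fun i => parityBit_candB hp hinj β i
  -- `v₂(b) = 0`, `v₂(n) = 1`
  have hb2 : parityBit 2 b = 0 := by
    unfold parityBit
    rw [hb, padicValRat_candB, padicValRat_bitProd_of_forall_ne hp hinj _ Nat.prime_two hp2]; rfl
  have hN2 : parityBit 2 N = 1 := by
    unfold parityBit
    have hprod0 : (∏ j, (p j : ℚ)) ≠ 0 :=
      Finset.prod_ne_zero_iff.mpr fun j _ => Nat.cast_ne_zero.mpr (hp j).ne_zero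
    have h2 : padicValRat 2 (2 : ℚ) = 1 := by simpa using padicValRat.self (p := 2) one_lt_two
    have hodd : padicValRat 2 (∏ j, (p j : ℚ)) = 0 := by
      have : (∏ j, (p j : ℚ)) = (bitProd p (fun _ => 1) : ℚ) := by rw [cast_bitProd]; simp
      rw [this, padicValRat_bitProd_of_forall_ne hp hinj _ Nat.prime_two hp2]
    rw [hN, show ((2 * ∏ j, p j : ℕ) : ℚ) = 2 * ∏ j, (p j : ℚ) by push_cast; rfl,
      padicValRat.mul two_ne_zero hprod0, h2, hodd]; rfl
  -- `β ≠ 0`: some `βᵢ = 1`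
  obtain ⟨i, hi⟩ : ∃ i, β i ≠ 0 := Function.ne_iff.mp hβ
  refine rhoIndex_ne_one_of_witness hn P ?_
  rw [hclass]
  have key1 : ∀ u : ℚ, u ≠ 0 → parityBit (p i) u = 0 → sqClass b ≠ sqClass u := by
    intro u hu hpu h
    have hsq := sqClass_mul_eq_one_of_eq hb0 hu h
    have := parityBit_eq_zero_of_sqClass_eq_one (p := p i) (mul_ne_zero hb0 hu) hsq
    rw [parityBit_mul hb0 hu, hbit, hpu, add_zero] at this
    exact hi this
  have key2 : ∀ u : ℚ, u ≠ 0 → parityBit 2 u = 1 → sqClass b ≠ sqClass u := by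
    intro u hu hpu h
    have hsq := sqClass_mul_eq_one_of_eq hb0 hu h
    have := parityBit_eq_zero_of_sqClass_eq_one (p := 2) (mul_ne_zero hb0 hu) hsq
    rw [parityBit_mul hb0 hu, hb2, hpu, zero_add] at this
    exact one_ne_zero this
  have one_eq : (1 : SqUnits ℚ) = sqClass (1 : ℚ) := by rw [← mul_one (1 : ℚ), sqClass_mul_self]
  have pb1 : parityBit (p i) (1 : ℚ) = 0 := by unfold parityBit; rw [padicValRat.one]; rfl
  have pbm1 : parityBit (p i) (-1 : ℚ) = 0 := by unfold parityBit; rw [padicValRat.neg, padicValRat.one]; rfl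
  have pm1_2 : parityBit 2 (-1 : ℚ) = 0 := by unfold parityBit; rw [padicValRat.neg, padicValRat.one]; rfl
  have pN2' : parityBit 2 (-N) = 1 := by
    rw [show -N = N * (-1) by ring, parityBit_mul hN0 (by norm_num), hN2, pm1_2, add_zero]
  rintro (h | h | h | h)
  · exact key1 1 one_ne_zero pb1 (h.trans one_eq)
  · exact key1 (-1) (by norm_num) pbm1 h
  · exact key2 N hN0 hN2 h
  · exact key2 (-N) (neg_ne_zero.mpr hN0) pN2' h

end Even

end RhoMonskyKernel

end Literature.NumberTheory.EllipticCurves.TianYuanZhang2017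

end
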